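import Mathlib
import Summits.Ventures.PercRepro2.Sep2OShieldSums
import Summits.Ventures.PercRepro2.FMDecomp
import Summits.Ventures.PercRepro2.A3CutCrossFM
import Summits.Ventures.PercRepro2.A3PendantFreeRoot

/-!
# (FM) in the unified o-shield class: the centring inequality `γ ≤ γ₀` by Harris on the `A`-side
(blind cell PercRepro2, night-1 g33; proofs/NIGHT1-G33.md §10; census check_sep2_fm.py 103/103)

Setting of Sep2OShieldSums (`K = {x, a₁}` separating `o` from `{b, a₂}`).  By FMDecomp,
`FMfun(x) = btw(x) + (γ₀ − γ) · BR` with `BR ≥ 0` and `btw(x) = 0`, so (FM) is the single inequality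
`γ ≤ γ₀`, i.e. `D_o · P(Q) ≤ P(Q, o ∈ U) · D` (`UU_sep2`).  Across the separator `Q` splits into the two
products `N × {a₂ ↮ a₁}_B` and `{x ↔_A a₁} × {a₂ ↮ a₁, x ↮ a₂}_B` (`Q_eq_union`), `D = P_A(N) q₃`,
`D_o = P_A(N, a₁ ↔ o) q₃`, and `P(Q, o ∈ U) ≥ P(Q, o ↔_A a₁)`; the inequality reduces to the Harris
difference `P_A(x ↔ a₁, a₁ ↔ o) P_A(N) ≥ P_A(x ↔ a₁) P_A(N, a₁ ↔ o)` of the two increasing `A`-side events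
(`CrossShield.harris_diff_nonneg`).  Hence **`FM_sep2_o`** (and its mirror `FM_sep2_o_mirror`): (MEANS-a₃) ∧
(FM) hold at `x` in the whole unified o-shield class.  Standard axioms.
-/

namespace Summit.Ventures.PercRepro2

open UnionCluster CovForm CutV Sep2

namespace CovForm

namespace A3Fibre

namespace Sep2Shield

section FM

variable {V : Type*} {E : Type*} [Fintype V] [DecidableEq V] [Fintype E] [DecidableEq E]
  {R : Type*} [Field R] [LinearOrder R] [IsStrictOrderedRing R] {ends : E → Sym2 V} {x a₁ : V}
  {VA VB : Finset V} {EA EB : Set E} [DecidablePred (· ∈ EA)] [DecidablePred (· ∈ EB)] {p : E → R}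
  {o a₂ b : V}

omit [Fintype V] [DecidableEq V] [Fintype E] [DecidableEq E] [Field R] [LinearOrder R]
  [IsStrictOrderedRing R] [DecidablePred (· ∈ EA)] in
/-- For `u ∈ VB`, `u ↔ a₁` forces `u ↔_B a₁` or `u ↔_B x`. -/
lemma connB_or_of_conn (h : IsSep2 ends x a₁ ↑VA ↑VB EA EB) {ω : Config E} {u : V} (hu : u ∈ VB)
    (huv : Conn ends ω u a₁) :
    Conn ends (restrict EB ω) u a₁ ∨ Conn ends (restrict EB ω) u x := by
  by_contra hn
  have hn1 : ¬ Conn ends (restrict EB ω) u a₁ := fun hc => hn (Or.inl hc)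
  have hn2 : ¬ Conn ends (restrict EB ω) u x := fun hc => hn (Or.inr hc)
  let S : Set V := {w | Conn ends (restrict EB ω) u w}
  have hS : ∀ a ∈ S, ∀ b, (openGraph ends ω).Adj a b → b ∈ S := by
    intro a ha b hab
    rw [openGraph_adj] at hab
    obtain ⟨_, e, he, hends⟩ := hab
    rcases h.cover e with hA | hB
    · rcases h.eq_of_mem_both (h.ends_mem_of_mem_EA hA hends).1
        (mem_of_conn_restrict h.symm (Or.inl (Finset.mem_coe.2 hu)) ha) with rfl | rfl
      · exact absurd ha hn2
      · exact absurd ha hn1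
    · exact conn_trans ha (conn_restrict_of_openAdj hB he hends)
  exact hn1 (mem_of_conn_of_closed hS (conn_refl _ _ _) huv)

omit [Fintype V] [DecidableEq V] [Fintype E] [DecidableEq E] [Field R] [LinearOrder R]
  [IsStrictOrderedRing R] in
/-- **Path lemma under `x ↮_A a₁`**: two vertices of `VB ∪ {x, a₁}` are connected iff they are
connected by the `B`-edges alone (only the `A`-side link `x ↔_A a₁` needs to be absent). -/
theorem connB_iff_of_not_connA (h : IsSep2 ends x a₁ ↑VA ↑VB EA EB) {ω : Config E}
    (hxA : ¬ Conn ends (restrict EA ω) x a₁) {u v : V} (hu : u ∈ (↑VB : Set V) ∪ {x, a₁})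
    (hv : v ∈ (↑VB : Set V) ∪ {x, a₁}) :
    Conn ends ω u v ↔ Conn ends (restrict EB ω) u v := by
  refine ⟨fun huv => ?_, fun huv => conn_mono (restrict_le EB ω) huv⟩
  let S : Set V := {w | Conn ends (restrict EB ω) u w ∨
    (Conn ends (restrict EB ω) u x ∧ Conn ends (restrict EA ω) x w) ∨
    (Conn ends (restrict EB ω) u a₁ ∧ Conn ends (restrict EA ω) a₁ w)}
  have hS : ∀ a ∈ S, ∀ b, (openGraph ends ω).Adj a b → b ∈ S := by
    intro a ha b hab
    rw [openGraph_adj] at hab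
    obtain ⟨_, e, he, hends⟩ := hab
    rcases h.cover e with hA | hB
    · have hab' := conn_restrict_of_openAdj hA he hends
      rcases ha with h1 | ⟨h2, h2'⟩ | ⟨h3, h3'⟩
      · rcases h.eq_of_mem_both (h.ends_mem_of_mem_EA hA hends).1
          (mem_of_conn_restrict h.symm hu h1) with rfl | rfl
        · exact Or.inr (Or.inl ⟨h1, hab'⟩)
        · exact Or.inr (Or.inr ⟨h1, hab'⟩)
      · exact Or.inr (Or.inl ⟨h2, conn_trans h2' hab'⟩)
      · exact Or.inr (Or.inr ⟨h3, conn_trans h3' hab'⟩)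
    · have hab' := conn_restrict_of_openAdj hB he hends
      rcases ha with h1 | ⟨h2, h2'⟩ | ⟨h3, h3'⟩
      · exact Or.inl (conn_trans h1 hab')
      · rcases h.eq_of_mem_both (mem_of_conn_restrict h (Or.inr (Or.inl rfl)) h2')
          (h.symm.ends_mem_of_mem_EA hB hends).1 with rfl | rfl
        · exact Or.inl (conn_trans h2 hab')
        · exact absurd h2' hxA
      · rcases h.eq_of_mem_both (mem_of_conn_restrict h (Or.inr (Or.inr rfl)) h3')
          (h.symm.ends_mem_of_mem_EA hB hends).1 with rfl | rfl
        · exact absurd (conn_symm h3') hxA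
        · exact Or.inl (conn_trans h3 hab')
  have hv' : v ∈ S := mem_of_conn_of_closed hS (Or.inl (conn_refl _ _ _)) huv
  rcases hv' with h1 | ⟨h2, h2'⟩ | ⟨h3, h3'⟩
  · exact h1
  · rcases h.eq_of_mem_both (mem_of_conn_restrict h (Or.inr (Or.inl rfl)) h2') hv with rfl | rfl
    · exact h2
    · exact absurd h2' hxA
  · rcases h.eq_of_mem_both (mem_of_conn_restrict h (Or.inr (Or.inr rfl)) h3') hv with rfl | rfl
    · exact absurd (conn_symm h3') hxA
    · exact h3

omit [Fintype V] [DecidableEq V] [Fintype E] [DecidableEq E] [Field R] [LinearOrder R]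
  [IsStrictOrderedRing R] in
/-- **`Q` across the separator**: `Q = N × {a₂ ↮ a₁}_B ⊔ {x ↔_A a₁} × {a₂ ↮ a₁, x ↮ a₂}_B`. -/
lemma Q_eq_union (h : IsSep2 ends x a₁ ↑VA ↑VB EA EB) (h2 : a₂ ∈ VB) :
    avoidAll ends a₂ {a₁} =
      (sideEvent EA (connEvent ends x a₁)ᶜ ∩ sideEvent EB (avoidAll ends a₂ {a₁})) ∪
        (sideEvent EA (connEvent ends x a₁) ∩
          sideEvent EB (avoidAll ends a₂ {a₁} ∩ (connEvent ends x a₂)ᶜ)) := by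
  ext ω
  simp only [Set.mem_union, Set.mem_inter_iff, mem_sideEvent, mem_avoidAll, Finset.mem_singleton,
    forall_eq, Set.mem_compl_iff, mem_connEvent]
  constructor
  · intro hQ
    by_cases hA : Conn ends (restrict EA ω) x a₁
    · refine Or.inr ⟨hA, fun hc => hQ (conn_mono (restrict_le EB ω) hc), fun hc => ?_⟩
      exact hQ (conn_trans (conn_symm (conn_mono (restrict_le EB ω) hc))
        (conn_mono (restrict_le EA ω) hA))
    · exact Or.inl ⟨hA, fun hc => hQ (conn_mono (restrict_le EB ω) hc)⟩
  · rintro (⟨hA, hB⟩ | ⟨hA, hB, hx2⟩)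
    · intro hc
      exact hB ((connB_iff_of_not_connA h hA (Or.inl (Finset.mem_coe.2 h2)) (Or.inr (Or.inr rfl))).1 hc)
    · intro hc
      rcases connB_or_of_conn h h2 hc with hc' | hc'
      · exact hB hc'
      · exact hx2 (conn_symm hc')

omit [Fintype V] [DecidableEq V] [Fintype E] [DecidableEq E] [Field R] [LinearOrder R]
  [IsStrictOrderedRing R] [DecidablePred (· ∈ EB)] in
/-- The complement read on a side. -/
lemma sideEvent_compl' (A : Set (Config E)) : sideEvent EA Aᶜ = (sideEvent EA A)ᶜ := rfl

omit [Fintype V] [DecidableEq V] [LinearOrder R] [IsStrictOrderedRing R] in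
/-- `P(Q) = P_A(N) q′ + P_A(x ↔ a₁) q″`. -/
lemma prob_Q_eq_sep2 (h : IsSep2 ends x a₁ ↑VA ↑VB EA EB) (h2 : a₂ ∈ VB) :
    prob p (avoidAll ends a₂ {a₁}) =
      prob p (sideEvent EA (connEvent ends x a₁)ᶜ) * prob p (sideEvent EB (avoidAll ends a₂ {a₁})) +
        prob p (sideEvent EA (connEvent ends x a₁)) *
          prob p (sideEvent EB (avoidAll ends a₂ {a₁} ∩ (connEvent ends x a₂)ᶜ)) := by
  have hdisj : Disjoint
      (sideEvent EA (connEvent ends x a₁)ᶜ ∩ sideEvent EB (avoidAll ends a₂ {a₁}))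
      (sideEvent EA (connEvent ends x a₁) ∩
        sideEvent EB (avoidAll ends a₂ {a₁} ∩ (connEvent ends x a₂)ᶜ)) := by
    rw [Set.disjoint_left]
    rintro ω ⟨hA, _⟩ ⟨hA', _⟩
    exact hA hA'
  conv_lhs => rw [Q_eq_union h h2]
  rw [prob_union_of_disjoint p hdisj, prob_side_mul h, prob_side_mul h]

omit [Fintype V] [DecidableEq V] [LinearOrder R] [IsStrictOrderedRing R] in
/-- `P(Q, a₁ ↔_A o) = P_A(N, a₁ ↔ o) q′ + P_A(x ↔ a₁, a₁ ↔ o) q″`. -/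
lemma prob_Q_inter_oA_eq (h : IsSep2 ends x a₁ ↑VA ↑VB EA EB) (h2 : a₂ ∈ VB) :
    prob p (avoidAll ends a₂ {a₁} ∩ sideEvent EA (connEvent ends a₁ o)) =
      prob p (sideEvent EA ((connEvent ends x a₁)ᶜ ∩ connEvent ends a₁ o)) *
          prob p (sideEvent EB (avoidAll ends a₂ {a₁})) +
        prob p (sideEvent EA (connEvent ends x a₁ ∩ connEvent ends a₁ o)) *
          prob p (sideEvent EB (avoidAll ends a₂ {a₁} ∩ (connEvent ends x a₂)ᶜ)) := by
  conv_lhs => rw [Q_eq_union h h2, Set.union_inter_distrib_right]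
  have e1 : sideEvent EA (connEvent ends x a₁)ᶜ ∩ sideEvent EB (avoidAll ends a₂ {a₁}) ∩
      sideEvent EA (connEvent ends a₁ o) =
      sideEvent EA ((connEvent ends x a₁)ᶜ ∩ connEvent ends a₁ o) ∩
        sideEvent EB (avoidAll ends a₂ {a₁}) := by
    ext ω; simp only [Set.mem_inter_iff, mem_sideEvent]; tauto
  have e2 : sideEvent EA (connEvent ends x a₁) ∩
      sideEvent EB (avoidAll ends a₂ {a₁} ∩ (connEvent ends x a₂)ᶜ) ∩
        sideEvent EA (connEvent ends a₁ o) =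
      sideEvent EA (connEvent ends x a₁ ∩ connEvent ends a₁ o) ∩
        sideEvent EB (avoidAll ends a₂ {a₁} ∩ (connEvent ends x a₂)ᶜ) := by
    ext ω; simp only [Set.mem_inter_iff, mem_sideEvent]; tauto
  have hdisj : Disjoint
      (sideEvent EA ((connEvent ends x a₁)ᶜ ∩ connEvent ends a₁ o) ∩
        sideEvent EB (avoidAll ends a₂ {a₁}))
      (sideEvent EA (connEvent ends x a₁ ∩ connEvent ends a₁ o) ∩
        sideEvent EB (avoidAll ends a₂ {a₁} ∩ (connEvent ends x a₂)ᶜ)) := by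
    rw [Set.disjoint_left]
    rintro ω ⟨hA, _⟩ ⟨hA', _⟩
    exact hA.1 hA'.1
  rw [e1, e2, prob_union_of_disjoint p hdisj, prob_side_mul h, prob_side_mul h]

omit [Fintype V] [DecidableEq V] in
/-- `P(Q, o ∈ U) ≥ P(Q, a₁ ↔_A o)`. -/
lemma mU_ge_sep2 (hp : IsProbVec p) :
    prob p (avoidAll ends a₂ {a₁} ∩ sideEvent EA (connEvent ends a₁ o)) ≤
      LeafStep.mU p ends a₁ a₂ o := by
  unfold LeafStep.mU
  have h1 : prob p (avoidAll ends a₂ {a₁} ∩ sideEvent EA (connEvent ends a₁ o)) ≤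
      prob p (avoidAll ends a₂ {a₁} ∩ connEvent ends a₁ o) :=
    prob_mono hp fun ω hω => ⟨hω.1, conn_mono (restrict_le EA ω) hω.2⟩
  linarith [prob_nonneg hp (avoidAll ends a₂ {a₁} ∩ connEvent ends a₂ o)]

omit [Fintype V] [DecidableEq V] [LinearOrder R] [IsStrictOrderedRing R] in
/-- `D = P_A(N) q₃`. -/
lemma prob_PD_eq_sep2 (h : IsSep2 ends x a₁ ↑VA ↑VB EA EB) (h2 : a₂ ∈ VB) :
    prob p (PDEvent ends a₁ a₂ x) =
      prob p (sideEvent EA (connEvent ends x a₁)ᶜ) *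
        prob p (sideEvent EB ((connEvent ends x a₁)ᶜ ∩ (connEvent ends x a₂)ᶜ ∩
          (connEvent ends a₁ a₂)ᶜ)) := by
  rw [PDEvent_eq_prod h h2, prob_side_mul h]

omit [Fintype V] [DecidableEq V] [LinearOrder R] [IsStrictOrderedRing R] in
/-- `D_o = P_A(N, a₁ ↔ o) q₃`. -/
lemma Do_eq_sep2 (h : IsSep2 ends x a₁ ↑VA ↑VB EA EB) (ho : o ∈ VA) (h2 : a₂ ∈ VB) :
    Do p ends o a₁ a₂ x =
      prob p (sideEvent EA ((connEvent ends x a₁)ᶜ ∩ connEvent ends a₁ o)) *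
        prob p (sideEvent EB ((connEvent ends x a₁)ᶜ ∩ (connEvent ends x a₂)ᶜ ∩
          (connEvent ends a₁ a₂)ᶜ)) := by
  have hsub : (connEvent ends x a₁)ᶜ ∩ (connEvent ends x a₂)ᶜ ∩ (connEvent ends a₁ a₂)ᶜ ⊆
      (connEvent ends x a₁)ᶜ := fun ω hω => hω.1.1
  have hDo : PDEvent ends a₁ a₂ x ∩ connEvent ends a₂ o = ∅ := by
    ext ω
    simp only [PDEvent, Dtilde, UnionCluster.inU, Set.mem_inter_iff, mem_connEvent, Set.mem_compl_iff,
      Set.mem_union, not_or, Set.mem_empty_iff_false, iff_false, not_and]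
    rintro ⟨hQ, hx1, hx2⟩ hc
    rcases conn_cross h (Finset.mem_coe.2 ho) (Finset.mem_coe.2 h2) (conn_symm hc) with hox | hoa
    · exact hx2 (conn_symm (conn_trans hc hox))
    · exact hQ (conn_symm (conn_trans hc hoa))
  unfold Do
  rw [hDo, prob_empty, add_zero, PDEvent_eq_prod h h2, prob_N_inter_conn_o h ho hsub]

omit [Fintype V] [DecidableEq V] in
/-- **The centring inequality in the unified o-shield class**: `D_o · P(Q) ≤ P(Q, o ∈ U) · D`
(positive association of `U_o` and `U_x` on `Q`), by Harris on the `A`-side. -/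
theorem UU_sep2 (hp : IsProbVec p) (h : IsSep2 ends x a₁ ↑VA ↑VB EA EB) (ho : o ∈ VA) (h2 : a₂ ∈ VB) :
    Do p ends o a₁ a₂ x * prob p (avoidAll ends a₂ {a₁}) ≤
      LeafStep.mU p ends a₁ a₂ o * prob p (PDEvent ends a₁ a₂ x) := by
  have hH := CrossShield.harris_diff_nonneg hp
    (CrossShield.isUpperSet_sideEvent_cs EA (isUpperSet_connEvent ends x a₁))
    (CrossShield.isUpperSet_sideEvent_cs EA (isUpperSet_connEvent ends a₁ o))
  rw [← sideEvent_compl', sideEvent_inter, sideEvent_inter] at hH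
  have hmU := mU_ge_sep2 (p := p) (ends := ends) (a₁ := a₁) (a₂ := a₂) (o := o) (EA := EA) hp
  rw [prob_Q_inter_oA_eq h h2] at hmU
  rw [Do_eq_sep2 h ho h2, prob_PD_eq_sep2 h h2, prob_Q_eq_sep2 h h2]
  have hq3 := prob_nonneg hp (sideEvent EB ((connEvent ends x a₁)ᶜ ∩ (connEvent ends x a₂)ᶜ ∩
    (connEvent ends a₁ a₂)ᶜ))
  have hq2 := prob_nonneg hp (sideEvent EB (avoidAll ends a₂ {a₁} ∩ (connEvent ends x a₂)ᶜ))
  have hN := prob_nonneg hp (sideEvent EA (connEvent ends x a₁)ᶜ)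
  nlinarith [mul_nonneg (sub_nonneg.2 hmU) (mul_nonneg hN hq3), mul_nonneg hH (mul_nonneg hq2 hq3)]

omit [Fintype V] [DecidableEq V] in
/-- `γ ≤ γ₀` in the unified o-shield class. -/
theorem gamma_le_gamma0_sep2 (hp : IsProbVec p) (h : IsSep2 ends x a₁ ↑VA ↑VB EA EB) (ho : o ∈ VA)
    (h2 : a₂ ∈ VB) (hD : prob p (PDEvent ends a₁ a₂ x) ≠ 0) :
    gamma p ends o a₁ a₂ x ≤ gamma0 p ends o a₁ a₂ :=
  (FMDecomp.gamma_le_gamma0_iff hp hD).2 (UU_sep2 hp h ho h2)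

/-- **(FM) at `x` in the unified o-shield class** (`D ≠ 0`). -/
theorem FM_sep2_o_of_D (hp : IsProbVec p) (h : IsSep2 ends x a₁ ↑VA ↑VB EA EB) (ho : o ∈ VA)
    (h2 : a₂ ∈ VB) (hb : b ∈ VB) (hD : prob p (PDEvent ends a₁ a₂ x) ≠ 0) :
    FM p ends o a₁ a₂ x b :=
  FMDecomp.FM_of_A3Between_of_gamma_le hp hD (A3Between_sep2_o hp h ho h2 hb)
    (gamma_le_gamma0_sep2 hp h ho h2 hD)

omit [DecidablePred (· ∈ EA)] [DecidablePred (· ∈ EB)] in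
/-- The decomposition `FMfun = btw + (γ₀ − γ) BR` needs only `P(Q) ≠ 0` (at `D = 0` both `D_o` and
`γ` vanish). -/
lemma FMfun_eq_btw_add_of_Q (hp : IsProbVec p) (hQ : prob p (avoidAll ends a₂ {a₁}) ≠ 0) :
    FMfun p ends o a₁ a₂ x b = btw p ends o a₁ a₂ x b +
      (gamma0 p ends o a₁ a₂ - gamma p ends o a₁ a₂ x) *
        (EQb3 p ends a₁ a₂ x b -
          EQo p ends b a₁ a₂ * EQ3 p ends a₁ a₂ x / prob p (avoidAll ends a₂ {a₁}) +
          Do p ends b a₁ a₂ x -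
          prob p (PDEvent ends a₁ a₂ x) * LeafStep.mU p ends a₁ a₂ b /
            prob p (avoidAll ends a₂ {a₁})) := by
  have hDo : Do p ends o a₁ a₂ x = gamma p ends o a₁ a₂ x * prob p (PDEvent ends a₁ a₂ x) := by
    by_cases hD : prob p (PDEvent ends a₁ a₂ x) = 0
    · rw [hD, mul_zero, Do_eq_fibresA]
      exact sum_Su_fibresA_eq_zero_of_PD_eq_zero hp ends a₁ a₂ x o hD
    · unfold gamma
      rw [div_mul_cancel₀ _ hD]
  unfold FMfun
  rw [← RootEdge.btwg_gamma]
  unfold RootEdge.btwg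
  rw [FMDecomp.sum_term_shift hp (gamma p ends o a₁ a₂ x) (gamma0 p ends o a₁ a₂),
    FMDecomp.sum_SFg_shift (gamma p ends o a₁ a₂ x) (gamma0 p ends o a₁ a₂), ← EQb3_eq, ← EQ3_eq,
    ← EQo_eq p ends b a₁ a₂ x, ← Do_eq_fibresA p ends b a₁ a₂ x, ← Do_eq_fibresA p ends o a₁ a₂ x, hDo]
  unfold gamma0
  by_cases hD : prob p (PDEvent ends a₁ a₂ x) = 0
  · have hDb : Do p ends b a₁ a₂ x = 0 := by
      rw [Do_eq_fibresA]
      exact sum_Su_fibresA_eq_zero_of_PD_eq_zero hp ends a₁ a₂ x b hD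
    rw [hD, hDb]
    field_simp
    ring
  · field_simp
    ring

/-- **(FM) at `x` in the unified o-shield class**, unconditionally. -/
theorem FM_sep2_o (hp : IsProbVec p) (h : IsSep2 ends x a₁ ↑VA ↑VB EA EB) (ho : o ∈ VA)
    (h2 : a₂ ∈ VB) (hb : b ∈ VB) : FM p ends o a₁ a₂ x b := by
  by_cases hQ : prob p (avoidAll ends a₂ {a₁}) = 0
  · unfold FM
    rw [CutOBehind.FMfun_eq_zero_of_Q_eq_zero' hp o x b hQ]
  by_cases hD : prob p (PDEvent ends a₁ a₂ x) = 0
  · unfold FM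
    rw [FMfun_eq_btw_add_of_Q hp hQ]
    have hγ : gamma p ends o a₁ a₂ x = 0 := by
      unfold gamma
      rw [hD, div_zero]
    have hγ0 : 0 ≤ gamma0 p ends o a₁ a₂ := by
      unfold gamma0 LeafStep.mU
      exact div_nonneg (add_nonneg (prob_nonneg hp _) (prob_nonneg hp _)) (prob_nonneg hp _)
    rw [hγ, sub_zero]
    exact add_nonneg (A3Between_sep2_o hp h ho h2 hb) (mul_nonneg hγ0 (FMDecomp.BR_nonneg hp hQ))
  · exact FM_sep2_o_of_D hp h ho h2 hb hD

/-- (FM) at `x` in the mirrored unified o-shield class (`K = {x, a₂}`), unconditionally. -/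
theorem FM_sep2_o_mirror (hp : IsProbVec p) (h : IsSep2 ends x a₂ ↑VA ↑VB EA EB) (ho : o ∈ VA)
    (h1 : a₁ ∈ VB) (hb : b ∈ VB) : FM p ends o a₁ a₂ x b := by
  unfold FM
  rw [← FMfun_swap]
  exact FM_sep2_o hp h ho h1 hb

end FM

end Sep2Shield

end A3Fibre

end CovForm

end Summit.Ventures.PercRepro2
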